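import Summits.AtomisticToContinuum.Crystallization.Theorems.ExcessDecayLiouvilleTwoLatticeForce

/-!
# Route `ExcessDecayLiouville`: the force-constant operator commutes with lattice translations

Step (c2) of the energy route for item `ExcessDecay` (stmt-AtomisticToContinuum-9334): the site set of
an admissible datum is invariant under `p ↦ p + Aλ`, `λ ∈ Λ₀` (`add_mem_sites₀`), and the force-constant
map depends on the bond vector only, so the operator `(L v)(p) = Σ'_{q≠p} K(p−q)(v p − v q)` commutes with
lattice translations: `(L (v ∘ (· + Aλ)))(p) = (L v)(p + Aλ)` (`opRow_translate`).  Consequently finite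
differences `D_λ v = v(· + Aλ) − v` of an `L`-harmonic displacement are `L`-harmonic (`opRow_diff`), which is
what lets the Caccioppoli inequality be iterated on difference quotients.  Pure reindexing of `tsum`s by the
self-equivalence `q ↦ q + Aλ` of the site type; no summability is needed for the translation identity.
All `[folklore]`; helper lemmas, nothing here closes an item.
-/

noncomputable section

namespace Summit.AtomisticToContinuum.Crystallization.Theorems.ExcessDecayLiouville

open scoped BigOperators Topology InnerProductSpace RealInnerProductSpace
open Literature.MathematicalPhysics.StatisticalMechanics
open Summit.AtomisticToContinuum.Crystallization.Theorems.PhononStabilityNegative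

section

variable {t : Fin 2 → EuclideanSpace ℝ (Fin 3)} {A : EuclideanSpace ℝ (Fin 3) →L[ℝ] EuclideanSpace ℝ (Fin 3)}

/-- Translation by a lattice vector as a self-equivalence of the site type. [folklore] -/
theorem exists_sitesShift {l : EuclideanSpace ℝ (Fin 3)} (hl : l ∈ Λ₀) :
    ∃ e : Sites₀ t A ≃ Sites₀ t A, ∀ q : Sites₀ t A, ((e q : Sites₀ t A) : EuclideanSpace ℝ (Fin 3)) = q + A l :=
  ⟨{ toFun := fun q => ⟨q + A l, add_mem_sites₀ q.2 hl⟩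
     invFun := fun q => ⟨q - A l, sub_mem_sites₀ q.2 hl⟩
     left_inv := fun q => by ext; simp
     right_inv := fun q => by ext; simp }, fun _ => rfl⟩

/-- **The operator commutes with lattice translations**: for `λ ∈ Λ₀` and any displacement `v`,
`(L (v ∘ (· + Aλ)))(p) = (L v)(p + Aλ)` — as an identity of row `tsum`s over the sites (the right-hand
side is the row at the site `p + Aλ`, written as a sum over `q` of the terms at `q + Aλ`). [folklore] -/
theorem opRow_translate (v : EuclideanSpace ℝ (Fin 3) → EuclideanSpace ℝ (Fin 3)) {l : EuclideanSpace ℝ (Fin 3)}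
    (hl : l ∈ Λ₀) (p : Sites₀ t A) :
    (∑' q : Sites₀ t A, (if (p : EuclideanSpace ℝ (Fin 3)) ≠ q then
        ((-((‖(p : EuclideanSpace ℝ (Fin 3)) - q‖ ^ 2)⁻¹) ^ 7 + ((‖(p : EuclideanSpace ℝ (Fin 3)) - q‖ ^ 2)⁻¹) ^ 4) •
            (v ((p : EuclideanSpace ℝ (Fin 3)) + A l) - v ((q : EuclideanSpace ℝ (Fin 3)) + A l)) +
          (2 * ⟪(p : EuclideanSpace ℝ (Fin 3)) - q,
              v ((p : EuclideanSpace ℝ (Fin 3)) + A l) - v ((q : EuclideanSpace ℝ (Fin 3)) + A l)⟫ *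
            (7 * ((‖(p : EuclideanSpace ℝ (Fin 3)) - q‖ ^ 2)⁻¹) ^ 8 - 4 * ((‖(p : EuclideanSpace ℝ (Fin 3)) - q‖ ^ 2)⁻¹) ^ 5)) •
            ((p : EuclideanSpace ℝ (Fin 3)) - q)) else 0)) =
    ∑' q : Sites₀ t A, (if (p : EuclideanSpace ℝ (Fin 3)) + A l ≠ q then
        ((-((‖(p : EuclideanSpace ℝ (Fin 3)) + A l - q‖ ^ 2)⁻¹) ^ 7 + ((‖(p : EuclideanSpace ℝ (Fin 3)) + A l - q‖ ^ 2)⁻¹) ^ 4) •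
            (v ((p : EuclideanSpace ℝ (Fin 3)) + A l) - v q) +
          (2 * ⟪(p : EuclideanSpace ℝ (Fin 3)) + A l - q, v ((p : EuclideanSpace ℝ (Fin 3)) + A l) - v q⟫ *
            (7 * ((‖(p : EuclideanSpace ℝ (Fin 3)) + A l - q‖ ^ 2)⁻¹) ^ 8 -
              4 * ((‖(p : EuclideanSpace ℝ (Fin 3)) + A l - q‖ ^ 2)⁻¹) ^ 5)) •
            ((p : EuclideanSpace ℝ (Fin 3)) + A l - q)) else 0) := by
  obtain ⟨e, he⟩ := exists_sitesShift (t := t) (A := A) hl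
  conv_rhs => rw [← e.tsum_eq]
  refine tsum_congr fun q => ?_
  have hq : ((e q : Sites₀ t A) : EuclideanSpace ℝ (Fin 3)) = q + A l := he q
  rw [hq]
  have hvec : (p : EuclideanSpace ℝ (Fin 3)) + A l - ((q : EuclideanSpace ℝ (Fin 3)) + A l) = p - q := by abel
  have hiff : ((p : EuclideanSpace ℝ (Fin 3)) + A l ≠ (q : EuclideanSpace ℝ (Fin 3)) + A l) ↔
      ((p : EuclideanSpace ℝ (Fin 3)) ≠ q) := by
    rw [Ne, Ne, add_left_inj]
  by_cases hpq : (p : EuclideanSpace ℝ (Fin 3)) = q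
  · rw [if_neg (fun h => h hpq), if_neg (fun h => (hiff.1 h) hpq)]
  · rw [if_pos hpq, if_pos (hiff.2 hpq), hvec]

/-- `K(e)` is additive in the displacement (restated with the `if`-guard of the operator rows). [folklore] -/
theorem opTerm_sub (v : EuclideanSpace ℝ (Fin 3) → EuclideanSpace ℝ (Fin 3)) (l : EuclideanSpace ℝ (Fin 3)) (p q : Sites₀ t A) :
    (if (p : EuclideanSpace ℝ (Fin 3)) ≠ q then ((-((‖(p : EuclideanSpace ℝ (Fin 3)) - q‖ ^ 2)⁻¹) ^ 7 + ((‖(p : EuclideanSpace ℝ (Fin 3)) - q‖ ^ 2)⁻¹) ^ 4) • ((v ((p : EuclideanSpace ℝ (Fin 3)) + A l) - v p) - (v ((q : EuclideanSpace ℝ (Fin 3)) + A l) - v q)) + (2 * ⟪(p : EuclideanSpace ℝ (Fin 3)) - q, (v ((p : EuclideanSpace ℝ (Fin 3)) + A l) - v p) - (v ((q : EuclideanSpace ℝ (Fin 3)) + A l) - v q)⟫ * (7 * ((‖(p : EuclideanSpace ℝ (Fin 3)) - q‖ ^ 2)⁻¹) ^ 8 - 4 * ((‖(p : EuclideanSpace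 ℝ (Fin 3)) - q‖ ^ 2)⁻¹) ^ 5)) • ((p : EuclideanSpace ℝ (Fin 3)) - q)) else 0) =
      (if (p : EuclideanSpace ℝ (Fin 3)) ≠ q then ((-((‖(p : EuclideanSpace ℝ (Fin 3)) - q‖ ^ 2)⁻¹) ^ 7 + ((‖(p : EuclideanSpace ℝ (Fin 3)) - q‖ ^ 2)⁻¹) ^ 4) • (v ((p : EuclideanSpace ℝ (Fin 3)) + A l) - v ((q : EuclideanSpace ℝ (Fin 3)) + A l)) + (2 * ⟪(p : EuclideanSpace ℝ (Fin 3)) - q, v ((p : EuclideanSpace ℝ (Fin 3)) + A l) - v ((q : EuclideanSpace ℝ (Fin 3)) + A l)⟫ * (7 * ((‖(p : EuclideanSpace ℝ (Fin 3)) - q‖ ^ 2)⁻¹) ^ 8 - 4 * ((‖(p : EuclideanSpace ℝ (Fin 3)) - q‖ ^ 2)⁻¹) ^ 5)) • ((p : EuclideanSpace ℝ (Fin 3)) - q)) else 0) - (if (p : EuclideanSpace ℝ (Fin 3)) ≠ q then ((-((‖(p : EuclideanSpace ℝ (Fin 3)) - q‖ ^ 2)⁻¹) ^ 7 + ((‖(p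 : EuclideanSpace ℝ (Fin 3)) - q‖ ^ 2)⁻¹) ^ 4) • (v p - v q) + (2 * ⟪(p : EuclideanSpace ℝ (Fin 3)) - q, v p - v q⟫ * (7 * ((‖(p : EuclideanSpace ℝ (Fin 3)) - q‖ ^ 2)⁻¹) ^ 8 - 4 * ((‖(p : EuclideanSpace ℝ (Fin 3)) - q‖ ^ 2)⁻¹) ^ 5)) • ((p : EuclideanSpace ℝ (Fin 3)) - q)) else 0) := by
  by_cases hpq : (p : EuclideanSpace ℝ (Fin 3)) = q
  · simp [hpq]
  · rw [if_pos hpq, if_pos hpq, if_pos hpq]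
    simp only [inner_sub_right]
    module

/-- **Finite differences of the displacement commute with the operator**: for `λ ∈ Λ₀`,
`(L (D_λ v))(p) = (L v)(p + Aλ) − (L v)(p)` with `D_λ v = v(· + Aλ) − v`, provided the two rows involved are
summable (e.g. `v` bounded, `summable_opRow_of_bounded`).  So differences of `L`-harmonic displacements are
`L`-harmonic. [folklore] -/
theorem opRow_diff (v : EuclideanSpace ℝ (Fin 3) → EuclideanSpace ℝ (Fin 3)) {l : EuclideanSpace ℝ (Fin 3)} (hl : l ∈ Λ₀) (p : Sites₀ t A)
    (h1 : Summable (fun q : Sites₀ t A => (if (p : EuclideanSpace ℝ (Fin 3)) ≠ q then ((-((‖(p : EuclideanSpace ℝ (Fin 3)) - q‖ ^ 2)⁻¹) ^ 7 + ((‖(p : EuclideanSpace ℝ (Fin 3)) - q‖ ^ 2)⁻¹) ^ 4) • (v ((p : EuclideanSpace ℝ (Fin 3)) + A l) - v ((q : EuclideanSpace ℝ (Fin 3)) + A l)) + (2 * ⟪(p : EuclideanSpace ℝ (Fin 3)) - q, v ((p : EuclideanSpace ℝ (Fin 3)) + A l) - v ((q : EuclideanSpace ℝ (Fin 3)) + A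 l)⟫ * (7 * ((‖(p : EuclideanSpace ℝ (Fin 3)) - q‖ ^ 2)⁻¹) ^ 8 - 4 * ((‖(p : EuclideanSpace ℝ (Fin 3)) - q‖ ^ 2)⁻¹) ^ 5)) • ((p : EuclideanSpace ℝ (Fin 3)) - q)) else 0)))
    (h2 : Summable (fun q : Sites₀ t A => (if (p : EuclideanSpace ℝ (Fin 3)) ≠ q then ((-((‖(p : EuclideanSpace ℝ (Fin 3)) - q‖ ^ 2)⁻¹) ^ 7 + ((‖(p : EuclideanSpace ℝ (Fin 3)) - q‖ ^ 2)⁻¹) ^ 4) • (v p - v q) + (2 * ⟪(p : EuclideanSpace ℝ (Fin 3)) - q, v p - v q⟫ * (7 * ((‖(p : EuclideanSpace ℝ (Fin 3)) - q‖ ^ 2)⁻¹) ^ 8 - 4 * ((‖(p : EuclideanSpace ℝ (Fin 3)) - q‖ ^ 2)⁻¹) ^ 5)) • ((p : EuclideanSpace ℝ (Fin 3)) - q)) else 0))) :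
    (∑' q : Sites₀ t A, (if (p : EuclideanSpace ℝ (Fin 3)) ≠ q then ((-((‖(p : EuclideanSpace ℝ (Fin 3)) - q‖ ^ 2)⁻¹) ^ 7 + ((‖(p : EuclideanSpace ℝ (Fin 3)) - q‖ ^ 2)⁻¹) ^ 4) • ((v ((p : EuclideanSpace ℝ (Fin 3)) + A l) - v p) - (v ((q : EuclideanSpace ℝ (Fin 3)) + A l) - v q)) + (2 * ⟪(p : EuclideanSpace ℝ (Fin 3)) - q, (v ((p : EuclideanSpace ℝ (Fin 3)) + A l) - v p) - (v ((q : EuclideanSpace ℝ (Fin 3)) + A l) - v q)⟫ * (7 * ((‖(p : EuclideanSpace ℝ (Fin 3)) - q‖ ^ 2)⁻¹) ^ 8 - 4 * ((‖(p : EuclideanSpace ℝ (Fin 3)) - q‖ ^ 2)⁻¹) ^ 5)) • ((p : EuclideanSpace ℝ (Fin 3)) - q)) else 0)) =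
      (∑' q : Sites₀ t A, (if (p : EuclideanSpace ℝ (Fin 3)) + A l ≠ q then ((-((‖(p : EuclideanSpace ℝ (Fin 3)) + A l - q‖ ^ 2)⁻¹) ^ 7 + ((‖(p : EuclideanSpace ℝ (Fin 3)) + A l - q‖ ^ 2)⁻¹) ^ 4) • (v ((p : EuclideanSpace ℝ (Fin 3)) + A l) - v q) + (2 * ⟪(p : EuclideanSpace ℝ (Fin 3)) + A l - q, v ((p : EuclideanSpace ℝ (Fin 3)) + A l) - v q⟫ * (7 * ((‖(p : EuclideanSpace ℝ (Fin 3)) + A l - q‖ ^ 2)⁻¹) ^ 8 - 4 * ((‖(p : EuclideanSpace ℝ (Fin 3)) + A l - q‖ ^ 2)⁻¹) ^ 5)) • ((p : EuclideanSpace ℝ (Fin 3)) + A l - q)) else 0)) - ∑' q : Sites₀ t A, (if (p : EuclideanSpace ℝ (Fin 3)) ≠ q then ((-((‖(p : EuclideanSpace ℝ (Fin 3)) - q‖ ^ 2)⁻¹) ^ 7 + ((‖(p : EuclideanSpace ℝ (Fin 3)) - q‖ ^ 2)⁻¹) ^ 4) • (v p - v q) + (2 * ⟪(p : EuclideanSpace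 ℝ (Fin 3)) - q, v p - v q⟫ * (7 * ((‖(p : EuclideanSpace ℝ (Fin 3)) - q‖ ^ 2)⁻¹) ^ 8 - 4 * ((‖(p : EuclideanSpace ℝ (Fin 3)) - q‖ ^ 2)⁻¹) ^ 5)) • ((p : EuclideanSpace ℝ (Fin 3)) - q)) else 0) := by
  rw [← opRow_translate v hl p, ← h1.tsum_sub h2]
  exact tsum_congr fun q => opTerm_sub v l p q

end

end Summit.AtomisticToContinuum.Crystallization.Theorems.ExcessDecayLiouville

end
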